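import Literature.AlgebraicGeometry.Motives.GrassmannianChartSchemeRange
import HarnessLib

/-!
# Points of the chart scheme `Spec ℤ[X_p]`: the two inverse laws (lemmas for `toChartSchemeEquiv`)

Topic `Literature/AlgebraicGeometry/Motives`; namespace `Literature.AlgebraicGeometry.Motives.Grassmannian`.  PROOF-lane lemmas over the
objects of `GrassmannianChartScheme` ((A3.1), cell hodgecm-mathlib key (h4), B-p18 (g17)): a morphism `g : T ⟶ Spec ℤ[X_p]` is recovered
from the global sections `g^*(X_p)`, and the morphism built from a family `v : σ × Fin k → Γ(T, ⊤)` pulls `X_p` back to `v p`.  These are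
the `left_inv` / `right_inv` of the equivalence `(T ⟶ chartScheme k I) ≃ (σ × Fin k → Γ(T, ⊤))` (objects file
`GrassmannianChartSchemePoints`), i.e. the functor of points of the affine space `𝔸^{k · #σ}` (cf. Mathlib `AffineSpace.toSpecMvPolyIntEquiv`,
here with `ℤ` coefficients and variables in `Type u`).  THEOREMS ONLY.

* `toSpecΓ_specMap_chartRingHom_appTop` — `T → Spec Γ(T,⊤) → Spec ℤ[X]` built from `(g^*(X_p))_p` is `g`;
* `appTop_toSpecΓ_specMap_chartRingHom` — the morphism built from `v` pulls `X_p` back to `v p`.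

[Stacks 089T]; EGA I (1971) 9.7.4 and I.1.6.3 (morphisms into an affine scheme).
HC_CM is proved only modulo the 7 printed citations until rung 0 closes; nothing here is about HC.
-/

noncomputable section

namespace Literature.AlgebraicGeometry.Motives.Grassmannian

open CategoryTheory Opposite TensorProduct _root_.AlgebraicGeometry

universe u

variable (k : ℕ) {J : Type u}

/-- **A morphism `g : T ⟶ Spec ℤ[X_p]` is recovered from its global sections `g^*(X_p)`**:
`T.toSpecΓ ≫ Spec (X_p ↦ g^*(X_p)) = g` (`Spec` ⊣ `Γ` unit naturality + `ℤ[X]`-hom extensionality). [cite: StacksProject, Tag 089T] -/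
theorem toSpecΓ_specMap_chartRingHom_appTop (I : Fin k → J) {T : Scheme.{u}} (g : T ⟶ chartScheme k I) :
    T.toSpecΓ ≫ Spec.map (chartRingHom k I fun p => g.appTop ((Scheme.ΓSpecIso (chartRing k I)).inv (chartVar k I p))) = g := by
  have hφ : chartRingHom k I (fun p => g.appTop ((Scheme.ΓSpecIso (chartRing k I)).inv (chartVar k I p))) =
      (Scheme.ΓSpecIso (chartRing k I)).inv ≫ g.appTop :=
    chartRing_hom_ext k I fun p => by rw [chartRingHom_chartVar, CommRingCat.comp_apply]
  rw [hφ, Spec.map_comp, ← Category.assoc, ← Scheme.toSpecΓ_naturality, Category.assoc, toSpecΓ_SpecMap_ΓSpecIso_inv,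
    Category.comp_id]

/-- **The morphism built from a family of global sections pulls the variables back to that family**:
`(T.toSpecΓ ≫ Spec (X_p ↦ v p))^*(X_p) = v p`. [cite: StacksProject, Tag 089T] -/
theorem appTop_toSpecΓ_specMap_chartRingHom (I : Fin k → J) {T : Scheme.{u}} (v : {j : J // j ∉ Set.range I} × Fin k → Γ(T, ⊤))
    (p : {j : J // j ∉ Set.range I} × Fin k) :
    (T.toSpecΓ ≫ Spec.map (chartRingHom k I v)).appTop ((Scheme.ΓSpecIso (chartRing k I)).inv (chartVar k I p)) = v p := by
  have h1 : (Spec.map (chartRingHom k I v)).appTop ((Scheme.ΓSpecIso (chartRing k I)).inv (chartVar k I p)) =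
      (Scheme.ΓSpecIso _).inv (chartRingHom k I v (chartVar k I p)) := by
    rw [← CommRingCat.comp_apply, ← Scheme.ΓSpecIso_inv_naturality, CommRingCat.comp_apply]
  rw [Scheme.Hom.comp_appTop, CommRingCat.comp_apply, h1, chartRingHom_chartVar, Scheme.toSpecΓ_appTop,
    Iso.inv_hom_id_apply]

end Literature.AlgebraicGeometry.Motives.Grassmannian

end
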